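import Summits.BirchSwinnertonDyer.BirchSwinnertonDyer.Theorems.PrintCf2RubinValueTwoColemanCoinvariantCharGenerated
import Literature.NumberTheory.IwasawaTheory.IwasawaAlgebraTwoVarRegularProofs
import HarnessLib

/-!
# Brick (c) at `p = 2`, local `χ`-part, PRINCIPAL FORM: **`char_Λ ((N / Col 𝒞̄)_ε) = (L_ε)`** — the base `Λ = 𝒪_F⟦X⟧⟦T⟧` is factorial
# (a regular local ring of dimension `3`; Auslander–Buchsbaum), so `char_Λ (Λ ⧸ (L_ε)) = (L_ε)` and the «`Λ` factorial» input of the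
# closure / generated forms is DISCHARGED

Cell `bsd-print-cf2`, width seat `bsd-line-cf2c-w7` g14, route C `PrintCf2RubinValueTwo`, crux of record stmt-BirchSwinnertonDyer-24033
`TwoVariableMainConjAtSplitTwoQuad` (23720 nominal), BRICK §4(c); `--supports` the crux as a helper.  THEOREMS ONLY (0 sorry, no named fact, no
`def … : Prop`); Theses-free.  BSD is not proved by any of this.

g13's closure form `ColemanCoinvariantClosure.charIdeal_coinvariants_colemanImage_eq_of_units` and generated form
`ColemanCoinvariantGenerated.charIdeal_coinvariants_colemanImage_closure_eq_of_units` conclude `char_Λ ((N / Col 𝒞̄)_ε) = char_Λ (Λ ⧸ (L_ε))` and list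
«`Λ` factorial, to rewrite `char_Λ (Λ ⧸ (L)) = (L)`» among the remaining named inputs.  That input is a TREE THEOREM:
`Literature.NumberTheory.IwasawaTheory.uniqueFactorizationMonoid_powerSeries_powerSeries 𝒪` — for a discrete valuation ring `𝒪`, `𝒪⟦X⟧⟦T⟧` is a
regular local ring of dimension `3` (Matsumura 15.4 / 19.5), hence factorial (Auslander–Buchsbaum, Matsumura 20.3) — and `𝒪_F = 𝒪[F]` of a
non-archimedean local field is a DVR (Mathlib instance).  With `Module.charIdeal_quotient_span_singleton` (`char_R (R ⧸ (x)) = (x)` over a Noetherian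
factorial domain, Washington §13.2) this file records:

* `uniqueFactorizationMonoid_lambda₂` — `𝒪_F⟦X⟧⟦T⟧` is factorial (instance-free restatement for the lane's coefficient ring `𝒪[F]`);
* `charIdeal_lambda₂_quotient_span_singleton` — `char_Λ (Λ ⧸ (L)) = (L)` for `L ≠ 0`;
* ★★ `charIdeal_coinvariants_colemanImage_eq_span_of_units` — closure form, **`char_Λ ((N / Col C)_ε) = (L_ε)`**;
* ★★★ `charIdeal_coinvariants_colemanImage_closure_eq_span_of_units` — generated form, **`char_Λ ((N / Col 𝒞̄)_ε) = (L_ε)`** for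
  `𝒞̄ = closure ⟨β_c^{±1}⟩` (de Shalit III Lemma 1.10 (17) `char (𝒰/𝒞̄)_χ = (μ(𝔤; χ))` at `q = 2`, one prime, `d = 1`, `ε`-part, AS A PRINCIPAL IDEAL);
* ★★ `exists_charIdeal_coinvariants_colemanImage_closure_eq_span_of_units` — existence form from the levelwise unit relation.

Remaining named inputs after this file: the family itself (`β_𝔞 ∈ 𝒰¹_∞`, levelwise `hrel`, `σ̃_𝔞` fixing `E_∞`, translates `σ̃·β_𝔞 ∈ 𝒞̄`) and `L_ε ≠ 0`.

## References
* [deShalit1987] E. de Shalit, *Iwasawa theory of elliptic curves with complex multiplication* (1987), II §4.12 (33); III §1.4 (5), Cor. 1.5 (7),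
  Lemma 1.10 (17).
* [Matsumura1987] H. Matsumura, *Commutative Ring Theory* (1986), Thm. 15.4, 19.5, 20.3.
* [Washington1997] L. C. Washington, *Introduction to Cyclotomic Fields* (1997), §13.2.
-/

noncomputable section

set_option linter.dupNamespace false
set_option autoImplicit false

open Filter Topology
open scoped PowerSeries.WithPiTopology

namespace Summit.BirchSwinnertonDyer.BirchSwinnertonDyer.Theorems.PrintCf2.ColemanCoinvariantPrincipal

open Literature.NumberTheory.GaloisRepresentations Literature.NumberTheory.GaloisRepresentations.IsNonarchimedeanLocalField
  Literature.NumberTheory.GaloisRepresentations.LubinTate ValuativeRel Field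
open Literature.NumberTheory.EllipticCurves
open Summit.BirchSwinnertonDyer.BirchSwinnertonDyer.Theorems.PrintCf2.ColemanImage
open Summit.BirchSwinnertonDyer.BirchSwinnertonDyer.Theorems.PrintCf2.ColemanCoinvariantClosure
open Summit.BirchSwinnertonDyer.BirchSwinnertonDyer.Theorems.PrintCf2.ColemanCoinvariantGenerated

variable {F : Type} [Field F] [ValuativeRel F] [TopologicalSpace F] [IsNonarchimedeanLocalField F]

attribute [local instance] ltNormUniformSpace ltNormIsUniformAddGroup rk1 nF nE fintypeResidueField
attribute [local instance] RelNormCoherentUnits.instCommMonoid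

/-! ## §1. `Λ = 𝒪_F⟦X⟧⟦T⟧` is factorial; `char_Λ (Λ ⧸ (L)) = (L)` -/

/-- **`𝒪_F⟦X⟧⟦T⟧` is factorial**: `𝒪_F` is a DVR, `𝒪_F⟦X⟧⟦T⟧` is a regular local ring of dimension `3`, and regular local rings are UFDs
(Auslander–Buchsbaum) — the tree theorem `IwasawaTheory.uniqueFactorizationMonoid_powerSeries_powerSeries` at `𝒪 = 𝒪[F]`.
[cite: Matsumura1987, Thm. 20.3 with Thm. 15.4, 19.5] -/
theorem uniqueFactorizationMonoid_lambda₂ : UniqueFactorizationMonoid (PowerSeries (PowerSeries 𝒪[F])) :=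
  Literature.NumberTheory.IwasawaTheory.uniqueFactorizationMonoid_powerSeries_powerSeries 𝒪[F]

/-- **`char_Λ (Λ ⧸ (L)) = (L)`** for `L ≠ 0` in `Λ = 𝒪_F⟦X⟧⟦T⟧` (the characteristic power series of `Λ/(L)` is `L`).
[cite: Washington1997, §13.2] [cite: Matsumura1987, Thm. 20.3] -/
theorem charIdeal_lambda₂_quotient_span_singleton {L : PowerSeries (PowerSeries 𝒪[F])} (hL0 : L ≠ 0) :
    Module.charIdeal (PowerSeries (PowerSeries 𝒪[F])) (PowerSeries (PowerSeries 𝒪[F]) ⧸ Ideal.span {L}) = Ideal.span {L} :=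
  haveI := uniqueFactorizationMonoid_lambda₂ (F := F)
  Module.charIdeal_quotient_span_singleton hL0

/-! ## §2. The local (c)-identity as a principal ideal -/

variable {p : ℕ} [hp : Fact p.Prime] {d : ℕ} (hd : d.Coprime p)
variable {π : 𝒪[F]} (hπ : (valuation F).IsUniformizer (π : F))
variable (E : ℕ → IntermediateField F (AlgebraicClosure F)) [∀ m, FiniteDimensional F (E m)] [∀ m, Normal F (E m)]
  [∀ m, IsGalois F (E m)] (hmono : Monotone E) (hE : ∀ m, E m ≤ maxUnramified F) (hdeg : ∀ m, Module.finrank F (E m) = d * p ^ m)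
  {σ₀ : absoluteGaloisGroup F} (hσ₀ : IsAbsArithFrob σ₀) (hq : residueFieldCard F = 2)
variable (u : (LTCoeff F)ˣ) (hu : LTCoeff.of F π = residueFieldCard F * u) (γ w : 𝒪[F]ˣ) (hγ : (γ : 𝒪[F]) = 1 + π ^ 2 * w)
variable [IsAdicComplete (Ideal.span {intBase F (LTCoeff.of F π)}) (PowerSeries 𝒪[F])] [NeZero d]
variable {θ : ∀ m, unitBall (E m)} (hθ : ∀ m, IsIntegralNormalGen (E m) (θ m))
  (hcoh : ∀ m, unitBallTrace (hmono (Nat.le_succ m)) (θ (m + 1)) = θ m)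
variable [CharZero F] [IsAdicComplete (Ideal.span {(p : 𝒪[F])}) 𝒪[F]] (hI : Ideal.span {(p : 𝒪[F])} ≠ ⊤)
  (hud : ∀ m, (u : LTCoeff F) ^ Module.finrank F (E m) ≠ 1) (hm : ∃ m₁ : ℕ, LTCoeff.of F π ^ 2 ∣ LTCoeff.of F π - m₁)
variable [Unique (ZMod d)] (hN : DenseRange (Nat.cast : ℕ → 𝒪[F]))
variable (C : Set (∀ m, RelNormCoherentUnits hπ (E m))) (hC : IsClosed C) (hCsub : C ⊆ principalCoherentFamilies hπ E hmono)
  (h1 : (fun m => (RelNormCoherentUnits.one : RelNormCoherentUnits hπ (E m))) ∈ C)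
  (hmul : ∀ β ∈ C, ∀ β' ∈ C, (fun m => (β m).mul (β' m)) ∈ C) (hinv : ∀ β ∈ C, (fun m => (β m).inv hπ (E m)) ∈ C)
  (hgal : ∀ σ : absoluteGaloisGroup F, ∀ β ∈ C, (fun m => (β m).galAct σ) ∈ C)
variable {I : Type*} (β : I → ∀ m, RelNormCoherentUnits hπ (E m)) (hβC : ∀ c, β c ∈ C)
variable (ε : PowerSeries (PowerSeries 𝒪[F])) (σ : I → absoluteGaloisGroup F) (n : I → ℕ)

include hdeg hE hσ₀ hcoh hm h1 hmul hinv hβC in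
/-- ★★ **THE LOCAL (c)-IDENTITY, CLOSURE FORM, AS A PRINCIPAL IDEAL**: under the hypotheses of
`ColemanCoinvariantClosure.charIdeal_coinvariants_colemanImage_eq_of_units` (closed `Γ_F`-stable subgroup `C ⊆ 𝒰¹_∞` inside the closure of
`⟨β_c^{±1}⟩`, auxiliary indices `a₁`, `a₂`, `L_ε ≠ 0`, `φ_ε(Col β_c) = (t_{χ(σ̃_c)} − n_c)·L_ε`):
**`char_Λ ((N / Col C)_ε) = (L_ε)`**, `N = Col(𝒰¹_∞)`, `Λ = 𝒪_F⟦X⟧⟦T⟧`. [cite: deShalit1987, III §1.4 (5), Cor. 1.5 (7), Lemma 1.10 (17); II §4.12 (33)]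
[cite: Washington1997, §13.2] [cite: Matsumura1987, Thm. 20.3] -/
theorem charIdeal_coinvariants_colemanImage_eq_span_of_units (hε : ε * ε = 1)
    (hCgen : C ⊆ closure (Submonoid.closure (Set.range β ∪ Set.range fun c => fun m => ((β c) m).inv hπ (E m)) : Set _))
    (a₁ a₂ : I) (hv₁ : lubinTateChar hπ (σ a₁) = γ) (hn₁ : (π : 𝒪[F]) ∣ (n a₁ : 𝒪[F]) - 1)
    (ha₂ : tEval (natCast_sub_one_mem_span_intBase (F := F) hn₁)
      (colemanDeltaCoinvFun hπ hq (intBase F) u hu γ (eq_zero_of_C_pi_mul_eq_zero_integer hπ) w hγ ε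
          (unitTwistₗ hπ hq (intBase F) u hu γ (lubinTateChar hπ (σ a₂)) (TActModule.ofPS _ _ 1)) -
        PowerSeries.C ((n a₂ : ℕ) : PowerSeries 𝒪[F])) ≠ 0)
    (L : PowerSeries (PowerSeries 𝒪[F])) (hL0 : L ≠ 0)
    (hL : ∀ c : I, colemanDeltaCoinvFun hπ hq (intBase F) u hu γ (eq_zero_of_C_pi_mul_eq_zero_integer hπ) w hγ ε
        (colemanImage hd hπ E hmono hE hdeg hσ₀ hq u hu γ hθ hcoh (hCsub (hβC c)).1 default) =
      (colemanDeltaCoinvFun hπ hq (intBase F) u hu γ (eq_zero_of_C_pi_mul_eq_zero_integer hπ) w hγ ε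
          (unitTwistₗ hπ hq (intBase F) u hu γ (lubinTateChar hπ (σ c)) (TActModule.ofPS _ _ 1)) -
        PowerSeries.C ((n c : ℕ) : PowerSeries 𝒪[F])) * L) :
    Module.charIdeal (PowerSeries (PowerSeries 𝒪[F]))
        (↥(unitsImage₁ hd hπ E hmono hE hdeg hσ₀ hq u hu γ hθ hcoh hI hud) ⧸
          colemanCoinvRel hπ hq (intBase F) u hu γ ε (unitsImage₁ hd hπ E hmono hE hdeg hσ₀ hq u hu γ hθ hcoh hI hud)
            (fun _ hG => unitTwistₗ_mem_unitsImage₁ hd hπ E hmono hE hdeg hσ₀ hq u hu γ hθ hcoh hI hud (-1) hG)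
            (colemanImageSubmodule₁ hd hπ E hmono hE hdeg hσ₀ hq u hu γ hθ hcoh hN C hC hCsub h1 hmul hinv hgal)) =
      Ideal.span {L} := by
  rw [charIdeal_coinvariants_colemanImage_eq_of_units hd hπ E hmono hE hdeg hσ₀ hq u hu γ w hγ hθ hcoh hI hud hm hN C hC hCsub h1 hmul hinv
    hgal β hβC ε σ n hε hCgen a₁ a₂ hv₁ hn₁ ha₂ L hL0 hL, charIdeal_lambda₂_quotient_span_singleton hL0]

variable (hβ : ∀ c, β c ∈ principalCoherentFamilies hπ E hmono)
  (hgen : ∀ (σ : absoluteGaloisGroup F) (c : I), (fun m => ((β c) m).galAct σ) ∈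
    closure (Submonoid.closure (Set.range β ∪ Set.range fun c => fun m => ((β c) m).inv hπ (E m)) : Set (∀ m, RelNormCoherentUnits hπ (E m))))

include hdeg hE hσ₀ hcoh hm in
/-- ★★★ **THE LOCAL (c)-IDENTITY, GENERATED FORM, AS A PRINCIPAL IDEAL** (de Shalit III Lemma 1.10 (17) at `q = 2`, one prime, `d = 1`, `ε`-part):
for principal coherent tower families `β_c` whose Galois translates lie in `𝒞̄ = closure ⟨β_c^{±1}⟩`, under the auxiliary indices `a₁`
(`χ(σ̃_{a₁}) = γ`, `π ∣ n_{a₁} − 1`), `a₂` (`(t_{χ(σ̃_{a₂})} − n_{a₂})(n_{a₁} − 1) ≠ 0`) and `L_ε ≠ 0` with `φ_ε(Col β_c) = (t_{χ(σ̃_c)} − n_c)·L_ε`: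
**`char_Λ ((N / Col 𝒞̄)_ε) = (L_ε)`**, `N = Col(𝒰¹_∞)`, `Λ = 𝒪_F⟦X⟧⟦T⟧`. [cite: deShalit1987, III §1.4 (5), Cor. 1.5 (7), Lemma 1.10 (17); II §4.12 (33)]
[cite: Washington1997, §13.2] [cite: Matsumura1987, Thm. 20.3] -/
theorem charIdeal_coinvariants_colemanImage_closure_eq_span_of_units (hε : ε * ε = 1)
    (a₁ a₂ : I) (hv₁ : lubinTateChar hπ (σ a₁) = γ) (hn₁ : (π : 𝒪[F]) ∣ (n a₁ : 𝒪[F]) - 1)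
    (ha₂ : tEval (natCast_sub_one_mem_span_intBase (F := F) hn₁)
      (colemanDeltaCoinvFun hπ hq (intBase F) u hu γ (eq_zero_of_C_pi_mul_eq_zero_integer hπ) w hγ ε
          (unitTwistₗ hπ hq (intBase F) u hu γ (lubinTateChar hπ (σ a₂)) (TActModule.ofPS _ _ 1)) -
        PowerSeries.C ((n a₂ : ℕ) : PowerSeries 𝒪[F])) ≠ 0)
    (L : PowerSeries (PowerSeries 𝒪[F])) (hL0 : L ≠ 0)
    (hL : ∀ c : I, colemanDeltaCoinvFun hπ hq (intBase F) u hu γ (eq_zero_of_C_pi_mul_eq_zero_integer hπ) w hγ ε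
        (colemanImage hd hπ E hmono hE hdeg hσ₀ hq u hu γ hθ hcoh
          (closure_unitsGen_subset_principalCoherentFamilies hπ E hmono β hβ (mem_closure_unitsGen hπ E β c)).1 default) =
      (colemanDeltaCoinvFun hπ hq (intBase F) u hu γ (eq_zero_of_C_pi_mul_eq_zero_integer hπ) w hγ ε
          (unitTwistₗ hπ hq (intBase F) u hu γ (lubinTateChar hπ (σ c)) (TActModule.ofPS _ _ 1)) -
        PowerSeries.C ((n c : ℕ) : PowerSeries 𝒪[F])) * L) :
    Module.charIdeal (PowerSeries (PowerSeries 𝒪[F]))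
        (↥(unitsImage₁ hd hπ E hmono hE hdeg hσ₀ hq u hu γ hθ hcoh hI hud) ⧸
          colemanCoinvRel hπ hq (intBase F) u hu γ ε (unitsImage₁ hd hπ E hmono hE hdeg hσ₀ hq u hu γ hθ hcoh hI hud)
            (fun _ hG => unitTwistₗ_mem_unitsImage₁ hd hπ E hmono hE hdeg hσ₀ hq u hu γ hθ hcoh hI hud (-1) hG)
            (colemanImageSubmodule₁ hd hπ E hmono hE hdeg hσ₀ hq u hu γ hθ hcoh hN
              (closure (Submonoid.closure (Set.range β ∪ Set.range fun c => fun m => ((β c) m).inv hπ (E m)) :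
                Set (∀ m, RelNormCoherentUnits hπ (E m))))
              isClosed_closure (closure_unitsGen_subset_principalCoherentFamilies hπ E hmono β hβ) (one_mem_closure_unitsGen hπ E β)
              (mul_mem_closure_unitsGen hπ E β) (inv_mem_closure_unitsGen hπ E β) (galAct_mem_closure_unitsGen hπ E β hgen))) =
      Ideal.span {L} := by
  rw [charIdeal_coinvariants_colemanImage_closure_eq_of_units hd hπ E hmono hE hdeg hσ₀ hq u hu γ w hγ hθ hcoh hI hud hm hN β hβ hgen ε σ n
    hε a₁ a₂ hv₁ hn₁ ha₂ L hL0 hL, charIdeal_lambda₂_quotient_span_singleton hL0]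

include hdeg hE hσ₀ hcoh hm in
/-- ★★ **Existence form, principal**: under the LEVELWISE unit relation (II §2.4 (ii); `σ̃_c` fixing `E_∞`) and the two auxiliary indices, THE
series `L_ε` exists, `φ_ε(Col 𝒞̄) = (L_ε)·J_ε`, and — if `L_ε ≠ 0` — **`char_Λ ((N / Col 𝒞̄)_ε) = (L_ε)`**.
[cite: deShalit1987, II §2.4 (ii), §4.12 (29)–(33); III §1.4 (5), Lemma 1.10 (17)] [cite: Matsumura1987, Thm. 20.3] -/
theorem exists_charIdeal_coinvariants_colemanImage_closure_eq_span_of_units (hε : ε * ε = 1)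
    (hσE : ∀ (i : I) (m : ℕ) (x : E m), σ i • (x : AlgebraicClosure F) = x)
    (hrel : ∀ (a c : I) (m : ℕ), ((β a) m).galAct (σ c) * (β c) m ^ n a = ((β c) m).galAct (σ a) * (β a) m ^ n c)
    (a₁ a₂ : I) (hv₁ : lubinTateChar hπ (σ a₁) = γ) (hn₁ : (π : 𝒪[F]) ∣ (n a₁ : 𝒪[F]) - 1)
    (ha₂ : tEval (natCast_sub_one_mem_span_intBase (F := F) hn₁)
      (colemanDeltaCoinvFun hπ hq (intBase F) u hu γ (eq_zero_of_C_pi_mul_eq_zero_integer hπ) w hγ ε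
          (unitTwistₗ hπ hq (intBase F) u hu γ (lubinTateChar hπ (σ a₂)) (TActModule.ofPS _ _ 1)) -
        PowerSeries.C ((n a₂ : ℕ) : PowerSeries 𝒪[F])) ≠ 0) :
    ∃ L : PowerSeries (PowerSeries 𝒪[F]),
      (∀ c : I, colemanDeltaCoinvFun hπ hq (intBase F) u hu γ (eq_zero_of_C_pi_mul_eq_zero_integer hπ) w hγ ε
          (colemanImage hd hπ E hmono hE hdeg hσ₀ hq u hu γ hθ hcoh
            (closure_unitsGen_subset_principalCoherentFamilies hπ E hmono β hβ (mem_closure_unitsGen hπ E β c)).1 default) =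
        (colemanDeltaCoinvFun hπ hq (intBase F) u hu γ (eq_zero_of_C_pi_mul_eq_zero_integer hπ) w hγ ε
            (unitTwistₗ hπ hq (intBase F) u hu γ (lubinTateChar hπ (σ c)) (TActModule.ofPS _ _ 1)) -
          PowerSeries.C ((n c : ℕ) : PowerSeries 𝒪[F])) * L) ∧
      (colemanImageSubmodule₁ hd hπ E hmono hE hdeg hσ₀ hq u hu γ hθ hcoh hN
          (closure (Submonoid.closure (Set.range β ∪ Set.range fun c => fun m => ((β c) m).inv hπ (E m)) :
            Set (∀ m, RelNormCoherentUnits hπ (E m))))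
          isClosed_closure (closure_unitsGen_subset_principalCoherentFamilies hπ E hmono β hβ) (one_mem_closure_unitsGen hπ E β)
          (mul_mem_closure_unitsGen hπ E β) (inv_mem_closure_unitsGen hπ E β) (galAct_mem_closure_unitsGen hπ E β hgen)).map
          (colemanDeltaCoinvFun hπ hq (intBase F) u hu γ (eq_zero_of_C_pi_mul_eq_zero_integer hπ) w hγ ε) =
        Ideal.span {L} * Ideal.span (Set.range fun c =>
          colemanDeltaCoinvFun hπ hq (intBase F) u hu γ (eq_zero_of_C_pi_mul_eq_zero_integer hπ) w hγ ε
              (unitTwistₗ hπ hq (intBase F) u hu γ (lubinTateChar hπ (σ c)) (TActModule.ofPS _ _ 1)) -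
            PowerSeries.C ((n c : ℕ) : PowerSeries 𝒪[F])) ∧
      (L ≠ 0 → Module.charIdeal (PowerSeries (PowerSeries 𝒪[F]))
          (↥(unitsImage₁ hd hπ E hmono hE hdeg hσ₀ hq u hu γ hθ hcoh hI hud) ⧸
            colemanCoinvRel hπ hq (intBase F) u hu γ ε (unitsImage₁ hd hπ E hmono hE hdeg hσ₀ hq u hu γ hθ hcoh hI hud)
              (fun _ hG => unitTwistₗ_mem_unitsImage₁ hd hπ E hmono hE hdeg hσ₀ hq u hu γ hθ hcoh hI hud (-1) hG)
              (colemanImageSubmodule₁ hd hπ E hmono hE hdeg hσ₀ hq u hu γ hθ hcoh hN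
                (closure (Submonoid.closure (Set.range β ∪ Set.range fun c => fun m => ((β c) m).inv hπ (E m)) :
                  Set (∀ m, RelNormCoherentUnits hπ (E m))))
                isClosed_closure (closure_unitsGen_subset_principalCoherentFamilies hπ E hmono β hβ) (one_mem_closure_unitsGen hπ E β)
                (mul_mem_closure_unitsGen hπ E β) (inv_mem_closure_unitsGen hπ E β) (galAct_mem_closure_unitsGen hπ E β hgen))) =
        Ideal.span {L}) := by
  obtain ⟨L, hL, hmap, hchar⟩ := exists_charIdeal_coinvariants_colemanImage_closure_eq_of_units hd hπ E hmono hE hdeg hσ₀ hq u hu γ w hγ hθ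
    hcoh hI hud hm hN β hβ hgen ε σ n hε hσE hrel a₁ a₂ hv₁ hn₁ ha₂
  exact ⟨L, hL, hmap, fun hL0 => (hchar hL0).trans (charIdeal_lambda₂_quotient_span_singleton hL0)⟩

end Summit.BirchSwinnertonDyer.BirchSwinnertonDyer.Theorems.PrintCf2.ColemanCoinvariantPrincipal

end
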